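import Mathlib
import Summits.AtomisticToContinuum.Crystallization.Theorems.ThreeConeCertificateExactCertificateTransfer1DBulkDefect
import Summits.AtomisticToContinuum.Crystallization.Theorems.ThreeConeCertificateExactCertificateTransfer1DSlackDeleteEnergy
import Summits.AtomisticToContinuum.Crystallization.Theorems.ThreeConeCertificateExactCertificateTransfer1DSlackSiteEnergy
import Summits.AtomisticToContinuum.Crystallization.Theorems.ThreeConeCertificateExactCertificateTransfer1DSlackDeleteCrowded
import Summits.AtomisticToContinuum.Crystallization.Theorems.ThreeConeCertificateExactCertificateTransfer1DSlackContract
import Summits.AtomisticToContinuum.Crystallization.Theorems.ThreeConeCertificateExactCertificateTransfer1DSlackSqSum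
import Summits.AtomisticToContinuum.Crystallization.Theorems.ThreeConeCertificateExactCertificateTransfer1DSlackLocalCount
import Summits.AtomisticToContinuum.Crystallization.Theorems.ThreeConeCertificateExactCertificateTransfer1DSlackBudget

/-!
# Crux `ExactCertificate` (stmt-AtomisticToContinuum-11959), line `closure-makes-nogap-exact`: TRANSFER THEOREM IV —
# slack rigidity of the Lennard-Jones CHAIN (`SlackRigidity` with `3 ↦ 1`)

Support file (`--supports stmt-AtomisticToContinuum-11959`); nothing here closes the 3-D crux (`NoGap ∧ KeplerBound`,
`KeplerBound` = item 11961 ↔ 0627, open).  Continuation of the Transfer exhibits of c6 (`exactCertificate1D`,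
`keplerBound1D`, `HasPeriodicGroundStateEnergy lennardJones 1`) and c7 (`Crystallization1D`,
`bulkDefectVanish_lennardJones_one`).  Proved here: the registered assembly stub `stub_slackAssembly` of Transfer
skeleton IV and its corollary

* `slackRigidity_lennardJones_one` — the route's third crux `SlackRigidity` (item stmt-AtomisticToContinuum-11960) with
  `3 ↦ 1`, VERBATIM otherwise: there is one periodic configuration `P` of `ℝ¹` (the zero-pressure chain `aℤ`) such that
  for all `R, ε > 0`, along every sequence of injective configurations `x_N` of the line whose energy excess
  `E(x_N) − E(N)` is `o(N)`, the number of particles whose `R`-environment is not two-way `ε`-matched to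
  `x_i + A(P.points)` for a linear isometry `A` is `o(N)`.

With it the WHOLE route thesis `ExactCertificate ∧ SlackRigidity` of `ThreeConeCertificate`, and every hypothesis of its
deciding theorem `closes`, are theorems in d = 1.

Mechanism (THE ROUTE'S METHOD — certificate ⇒ Kepler bound ⇒ slack accounting ⇒ rigidity; `s = L(y) − N e_a ≥ 0` the
slack of the sorted configuration `y`, `e_a = Σ_{m≥1} V(ma) ≤ 0`, `a < 1` the zero-pressure lattice constant):
(1) CROWDING SURGERY (`stub_deleteCrowded`, from `stub_deleteEnergy` + `stub_siteEnergyHalf`): deleting the left particle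
of a closest pair with gap `< 3/4` lowers the line energy by `≥ 1/2`, so only `m ≤ 2s` deletions happen before all gaps are
`≥ 3/4`, and at most `2m` bad gaps disappear; (2) STRETCH SURGERY (`stub_contract`): replacing every gap `> 1` by `1`
lowers the energy and lands in the box `[3/4,1]`; (3) CONVEXITY WITH SLACK (`stub_sqSumOfSlack`): `Σ(a − gap)² ≤ 2(s + C_a)`;
(4) Chebyshev twice (`η`-bad gaps; contracted gaps via `1 − a > 0`); (5) LOCAL MATCHING COUNT (`stub_localCardBad`):
bad particles `≤ 2K + 2K·#η-bad gaps ≤ 2K + 2K(α s_N + β)` with `s_N ≤ (E(x_N) − E(N)) + C_a = o(N)`.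
-/

noncomputable section

namespace Summit.AtomisticToContinuum.Crystallization.Theorems.ThreeConeCertificateExactCertificate.Transfer1D

open Literature.MathematicalPhysics.StatisticalMechanics MeasureTheory Set Filter Topology
open scoped BigOperators

/-! ## The assembly, quantitative form: the defect count is linear in the energy excess -/

section Assembly

variable
  (hcrowd : (∀ (N : ℕ) (y : ℕ → ℝ), (∀ i j : ℕ, i < j → j < N → y i < y j) →
      ∃ (m n : ℕ) (z : ℕ → ℝ), m + n = N ∧ (∀ i j : ℕ, i < j → j < n → z i < z j) ∧
        (∀ i : ℕ, i + 1 < n → 3 / 4 ≤ z (i + 1) - z i) ∧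
        ∑ i ∈ Finset.range n, ∑ j ∈ Finset.Ico (i + 1) n, lennardJones (|z j - z i|) + m / 2 ≤
          ∑ i ∈ Finset.range N, ∑ j ∈ Finset.Ico (i + 1) N, lennardJones (|y j - y i|) ∧
        ∀ (p : ℝ → Prop) [DecidablePred p],
          ((Finset.range (N - 1)).filter (fun l => p (y (l + 1) - y l))).card ≤
            ((Finset.range (n - 1)).filter (fun l => p (z (l + 1) - z l))).card + 2 * m))
  (hcontract : (∀ (n : ℕ) (y : ℕ → ℝ), (∀ i j : ℕ, i < j → j < n → y i < y j) →
      (∀ i : ℕ, i + 1 < n → 3 / 4 ≤ y (i + 1) - y i) →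
      ∃ z : ℕ → ℝ, (∀ i j : ℕ, i < j → j < n → z i < z j) ∧
        (∀ i : ℕ, i + 1 < n → z (i + 1) - z i = min (y (i + 1) - y i) 1) ∧
        ∑ i ∈ Finset.range n, ∑ j ∈ Finset.Ico (i + 1) n, lennardJones (|z j - z i|) ≤
          ∑ i ∈ Finset.range n, ∑ j ∈ Finset.Ico (i + 1) n, lennardJones (|y j - y i|)))
  (hsq : (∀ (a eA C s : ℝ), 3 / 4 ≤ a → a ≤ 1 →
      (∀ N : ℕ, ∑ d ∈ Finset.range N, ((N : ℝ) - d) * lennardJones (d * a) ≤ N * eA + C) →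
      ∀ (n : ℕ) (z : ℕ → ℝ), (∀ i j : ℕ, i < j → j < n → z i < z j) →
        (∀ i : ℕ, i + 1 < n → 3 / 4 ≤ z (i + 1) - z i ∧ z (i + 1) - z i ≤ 1) →
        (∀ y' : ℕ → ℝ, (∀ i j : ℕ, i < j → j < n → y' i < y' j) →
          (n : ℝ) * eA ≤ ∑ i ∈ Finset.range n, ∑ j ∈ Finset.Ico (i + 1) n, lennardJones (|y' j - y' i|)) →
        ∑ i ∈ Finset.range n, ∑ j ∈ Finset.Ico (i + 1) n, lennardJones (|z j - z i|) ≤ n * eA + s →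
        ∑ i ∈ Finset.range (n - 1), (a - (z (i + 1) - z i)) ^ 2 ≤ 2 * (s + C)))
  (hcount : (∀ (a : ℝ) (P : PeriodicConfiguration 1) (e : ℤ ≃ P.points), 3 / 4 ≤ a →
      (∀ k : ℤ, ((e k : P.points) : EuclideanSpace ℝ (Fin 1)) = EuclideanSpace.single (0 : Fin 1) ((k : ℝ) * a)) →
      ∀ (R ε : ℝ), 0 < R → 0 < ε →
      ∀ (N : ℕ) (x : Fin N → EuclideanSpace ℝ (Fin 1)) (σ : Equiv.Perm (Fin N)) (y : ℕ → ℝ),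
        (∀ i j : ℕ, i < j → j < N → y i < y j) →
        (∀ i : Fin N, x (σ i) = EuclideanSpace.single (0 : Fin 1) (y i)) →
        ((Nat.card {i : Fin N // ¬ ∃ A : EuclideanSpace ℝ (Fin 1) →ₗᵢ[ℝ] EuclideanSpace ℝ (Fin 1),
            (∀ p ∈ P.points, ‖p‖ ≤ R → ∃ j : Fin N, dist (x j) (x i + A p) ≤ ε) ∧
            (∀ j : Fin N, dist (x j) (x i) ≤ R → ∃ p ∈ P.points, dist (x j) (x i + A p) ≤ ε)} : ℕ) : ℝ) ≤
          2 * (⌈2 * R⌉₊ + 1 : ℕ) + 2 * (⌈2 * R⌉₊ + 1 : ℕ) *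
            (((Finset.range (N - 1)).filter (fun l =>
                min (ε / (⌈2 * R⌉₊ + 1 : ℕ)) (1 / 4) < |a - (y (l + 1) - y l)|)).card : ℝ)))
  (hbudget : (∀ a : ℝ, 0 < a →
      HasSum (fun k : ℕ => ((k : ℝ) + 1) * ((((k : ℝ) + 1) * a)⁻¹ ^ 7 - (((k : ℝ) + 1) * a)⁻¹ ^ 13)) 0 →
      a < 1 ∧ ∑' k : ℕ, lennardJones (((k : ℝ) + 1) * a) ≤ 0))

include hcrowd hcontract hsq hcount hbudget

/-- **QUANTITATIVE SLACK RIGIDITY of the Lennard-Jones chain** (from the five stubs): there is one periodic configuration `P`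
of `ℝ¹` (the zero-pressure chain `aℤ`) such that for all `R, ε > 0` there are constants `A, B ≥ 0` with: for EVERY `N` and
EVERY configuration `x` of `N` distinct points of the line, the number of particles whose `R`-environment is not two-way
`ε`-matched to `x_i + A'(P.points)` (`A'` a linear isometry; the identity suffices) is at most `A + B·(E(x) − E(N))` —
the defect count is LINEAR IN THE ENERGY EXCESS, uniformly in `N`.  Mechanism in the module docstring. [folklore] -/
theorem slack_rate : ∃ P : PeriodicConfiguration 1, ∀ R ε : ℝ, 0 < R → 0 < ε → ∃ A B : ℝ, 0 ≤ A ∧ 0 ≤ B ∧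
      ∀ (N : ℕ) (x : Fin N → EuclideanSpace ℝ (Fin 1)), Function.Injective x →
        ((Nat.card {i : Fin N // ¬ ∃ A : EuclideanSpace ℝ (Fin 1) →ₗᵢ[ℝ] EuclideanSpace ℝ (Fin 1),
            (∀ p ∈ P.points, ‖p‖ ≤ R → ∃ j : Fin N, dist (x j) (x i + A p) ≤ ε) ∧
            (∀ j : Fin N, dist (x j) (x i) ≤ R → ∃ p ∈ P.points, dist (x j) (x i + A p) ≤ ε)} : ℕ) : ℝ) ≤
          A + B * (interactionEnergy lennardJones x - groundStateEnergy lennardJones 1 N) := by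
  -- constants: lattice constant `a ∈ [3/4,1)`, `a⁶ > 1/2`, the chain `P = aℤ`, the budget `C`, `e_a ≤ 0`
  obtain ⟨a, ha, hz⟩ := zeroPressure_exists
  obtain ⟨ha34, ha1⟩ := stub_aBounds a ha hz
  obtain ⟨halt, heA'⟩ := hbudget a ha hz
  obtain ⟨P, e, he⟩ := stub_chainPoints a ha
  obtain ⟨C₀, hC₀⟩ := stub_chainBudget a ha
  set eA : ℝ := ∑' k : ℕ, lennardJones (((k : ℝ) + 1) * a) with heAdef
  set C : ℝ := max C₀ 0 with hCdef
  have hC0 : 0 ≤ C := le_max_right _ _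
  have hC : ∀ N : ℕ, ∑ d ∈ Finset.range N, ((N : ℝ) - d) * lennardJones (d * a) ≤ N * eA + C :=
    fun N => (hC₀ N).trans (by linarith [le_max_left C₀ 0])
  have heA : eA ≤ 0 := heA'
  -- the Kepler bound in line form
  have hkepLine : ∀ (n : ℕ) (y' : ℕ → ℝ), (∀ i j : ℕ, i < j → j < n → y' i < y' j) →
      (n : ℝ) * eA ≤ ∑ i ∈ Finset.range n, ∑ j ∈ Finset.Ico (i + 1) n, lennardJones (|y' j - y' i|) := by
    intro n y' hy'
    rw [← stub_lineSort.1 lennardJones n y']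
    exact stub_keplerExplicit a ha hz n _ (pos1d_embed_injective n y' fun i j hij hjN => (hy' i j hij hjN).ne)
  -- the chain trial state: `E(N) ≤ N e_a + C`
  have hgs : ∀ N : ℕ, groundStateEnergy lennardJones 1 N ≤ N * eA + C := by
    intro N
    obtain ⟨hinj, hE⟩ := stub_chainEnergy a ha N
    calc groundStateEnergy lennardJones 1 N ≤ interactionEnergy lennardJones _ := groundStateEnergy_lennardJones_le hinj
      _ = ∑ d ∈ Finset.range N, ((N : ℝ) - d) * lennardJones (d * a) := hE
      _ ≤ N * eA + C := hC N
  refine ⟨P, fun R ε hR hε => ?_⟩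
  -- constants of the count
  set K : ℕ := ⌈2 * R⌉₊ + 1 with hKdef
  set η : ℝ := min (ε / K) (1 / 4) with hηdef
  have hKpos : (0 : ℝ) < K := by positivity
  have hK0 : (0 : ℝ) ≤ 2 * K := by positivity
  have hη : 0 < η := lt_min (div_pos hε hKpos) (by norm_num)
  have h1a : 0 < 1 - a := by linarith
  set γ : ℝ := 8 / (1 - a) ^ 2 + 2 / η ^ 2 with hγdef
  have hγ0 : 0 ≤ γ := by positivity
  refine ⟨2 * K + 2 * K * ((4 + γ) * C + C * γ), 2 * K * (4 + γ), by positivity, by positivity, fun N x hx => ?_⟩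
  -- sort
  obtain ⟨σ, y, hymono, hyx⟩ := stub_lineSort.2 N x hx
  have hE : ∑ i ∈ Finset.range N, ∑ j ∈ Finset.Ico (i + 1) N, lennardJones (|y j - y i|) =
      interactionEnergy lennardJones x := by
    rw [← stub_lineSort.1 lennardJones N y]
    have hfun : (fun i : Fin N => EuclideanSpace.single (0 : Fin 1) (y i)) = x ∘ σ :=
      funext fun i => (hyx i).symm
    rw [hfun, interactionEnergy_comp_equiv]
  -- the slack `s = E(x) − N e_a ≥ 0`, and `s ≤ (E(x) − E(N)) + C`
  set s : ℝ := interactionEnergy lennardJones x - N * eA with hsdef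
  have hs0 : 0 ≤ s := by
    have h := hkepLine N y hymono
    rw [hE] at h
    simp only [hsdef]
    linarith
  have hsD : s ≤ (interactionEnergy lennardJones x - groundStateEnergy lennardJones 1 N) + C := by
    simp only [hsdef]
    linarith [hgs N]
  -- (5) the local count
  have hcnt := hcount a P e ha34 he R ε hR hε N x σ y hymono hyx
  -- (1) crowding surgery: `m ≤ 2s` deletions
  obtain ⟨m, n, z, hmn, hzmono, hzgap, hzE, hzcount⟩ := hcrowd N y hymono
  rw [hE] at hzE
  have hzKep := hkepLine n z hzmono
  have hNmn : (N : ℝ) = m + n := by rw [← hmn]; push_cast; ring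
  have hmeA : (m : ℝ) * eA ≤ 0 := mul_nonpos_iff.2 (Or.inl ⟨Nat.cast_nonneg m, heA⟩)
  have hm : (m : ℝ) ≤ 2 * s := by
    simp only [hsdef]
    nlinarith
  -- (2) stretch surgery: into the box, slack still `≤ s`
  obtain ⟨w, hwmono, hwgap, hwE⟩ := hcontract n z hzmono hzgap
  have hwbox : ∀ i : ℕ, i + 1 < n → 3 / 4 ≤ w (i + 1) - w i ∧ w (i + 1) - w i ≤ 1 := by
    intro i hi
    rw [hwgap i hi]
    exact ⟨le_min (hzgap i hi) (by norm_num), min_le_right _ _⟩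
  have hwslack : ∑ i ∈ Finset.range n, ∑ j ∈ Finset.Ico (i + 1) n, lennardJones (|w j - w i|) ≤ n * eA + s := by
    simp only [hsdef]
    nlinarith
  -- (3) convexity with slack
  have hsqw := hsq a eA C s ha34 ha1 hC n w hwmono hwbox (hkepLine n) hwslack
  -- (4) Chebyshev twice on `w`, then back to `z` and to `y`
  have hcheb1 := pos1d_card_badGap_le (n - 1) (fun i => a - (w (i + 1) - w i)) (2 * (s + C)) η hη hsqw
  have hcheb2 := pos1d_card_badGap_le (n - 1) (fun i => a - (w (i + 1) - w i)) (2 * (s + C)) ((1 - a) / 2)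
    (by linarith) hsqw
  have hBz : ((((Finset.range (n - 1)).filter fun l => η < |a - (z (l + 1) - z l)|).card : ℕ) : ℝ) ≤
      2 * (s + C) / η ^ 2 + 2 * (s + C) / ((1 - a) / 2) ^ 2 := by
    have hsub : ((Finset.range (n - 1)).filter fun l => η < |a - (z (l + 1) - z l)|) ⊆
        ((Finset.range (n - 1)).filter fun l => η < |a - (w (l + 1) - w l)|) ∪
          ((Finset.range (n - 1)).filter fun l => (1 - a) / 2 < |a - (w (l + 1) - w l)|) := by
      intro l hl
      rw [Finset.mem_filter, Finset.mem_range] at hl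
      obtain ⟨hln, hlbad⟩ := hl
      have hln' : l + 1 < n := by omega
      rw [Finset.mem_union, Finset.mem_filter, Finset.mem_filter, Finset.mem_range, hwgap l hln']
      by_cases hle : z (l + 1) - z l ≤ 1
      · left
        rw [min_eq_left hle]
        exact ⟨hln, hlbad⟩
      · right
        rw [not_le] at hle
        rw [min_eq_right hle.le]
        refine ⟨hln, ?_⟩
        rw [abs_of_neg (by linarith)]
        linarith
    calc ((((Finset.range (n - 1)).filter fun l => η < |a - (z (l + 1) - z l)|).card : ℕ) : ℝ)
        ≤ ((((Finset.range (n - 1)).filter fun l => η < |a - (w (l + 1) - w l)|) ∪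
            ((Finset.range (n - 1)).filter fun l => (1 - a) / 2 < |a - (w (l + 1) - w l)|)).card : ℝ) := by
          exact_mod_cast Finset.card_le_card hsub
      _ ≤ ((((Finset.range (n - 1)).filter fun l => η < |a - (w (l + 1) - w l)|).card : ℕ) : ℝ) +
            ((((Finset.range (n - 1)).filter fun l => (1 - a) / 2 < |a - (w (l + 1) - w l)|).card : ℕ) : ℝ) := by
          exact_mod_cast Finset.card_union_le _ _
      _ ≤ 2 * (s + C) / η ^ 2 + 2 * (s + C) / ((1 - a) / 2) ^ 2 := add_le_add hcheb1 hcheb2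
  have htrans := hzcount (fun t => η < |a - t|)
  have hBy : ((((Finset.range (N - 1)).filter fun l => η < |a - (y (l + 1) - y l)|).card : ℕ) : ℝ) ≤
      4 * s + (s + C) * γ := by
    have h1 : ((((Finset.range (N - 1)).filter fun l => η < |a - (y (l + 1) - y l)|).card : ℕ) : ℝ) ≤
        ((((Finset.range (n - 1)).filter fun l => η < |a - (z (l + 1) - z l)|).card : ℕ) : ℝ) + 2 * m := by
      exact_mod_cast htrans
    have h2 : 2 * (s + C) / η ^ 2 + 2 * (s + C) / ((1 - a) / 2) ^ 2 = (s + C) * γ := by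
      simp only [hγdef]
      field_simp
      ring
    linarith
  -- assemble: `card ≤ 2K + 2K(4s + (s + C)γ) ≤ A + B (E(x) − E(N))`
  have h3 : 4 * s + (s + C) * γ ≤
      (4 + γ) * ((interactionEnergy lennardJones x - groundStateEnergy lennardJones 1 N) + C) + C * γ := by
    have h := mul_le_mul_of_nonneg_right hsD hγ0
    linarith
  calc _ ≤ 2 * (K : ℝ) + 2 * K * ((((Finset.range (N - 1)).filter fun l =>
          η < |a - (y (l + 1) - y l)|).card : ℕ) : ℝ) := hcnt
    _ ≤ 2 * K + 2 * K * (4 * s + (s + C) * γ) := by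
        have := mul_le_mul_of_nonneg_left hBy hK0
        linarith
    _ ≤ 2 * K + 2 * K * ((4 + γ) * ((interactionEnergy lennardJones x - groundStateEnergy lennardJones 1 N) + C)
          + C * γ) := by
        have := mul_le_mul_of_nonneg_left h3 hK0
        linarith
    _ = 2 * K + 2 * K * ((4 + γ) * C + C * γ) +
          2 * K * (4 + γ) * (interactionEnergy lennardJones x - groundStateEnergy lennardJones 1 N) := by ring

end Assembly

/-! ## The registered assembly stub and the Transfer theorems -/

/-- **Registered stub `stub_slackAssembly` — THE ASSEMBLY of Transfer skeleton IV.**  The crowding surgery (B), the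
stretch surgery (C), convexity with slack (D) and the local matching count (E), together with the landed d = 1 budget
(`stub_keplerExplicit`, `stub_chainEnergy`, `stub_chainBudget`, `stub_aBounds`, `stub_chainPoints`, `stub_lineSort`) and the
budget sharpening (G) `stub_slackBudget` (`a < 1`, `e_a ≤ 0`), give `SlackRigidity` with `3 ↦ 1`: by `slack_rate` the bad particles number
`≤ A + B·(E(x_N) − E(N)) = o(N)`. [folklore] -/
theorem stub_slackAssembly :
    (∀ (N : ℕ) (y : ℕ → ℝ), (∀ i j : ℕ, i < j → j < N → y i < y j) →
      ∃ (m n : ℕ) (z : ℕ → ℝ), m + n = N ∧ (∀ i j : ℕ, i < j → j < n → z i < z j) ∧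
        (∀ i : ℕ, i + 1 < n → 3 / 4 ≤ z (i + 1) - z i) ∧
        ∑ i ∈ Finset.range n, ∑ j ∈ Finset.Ico (i + 1) n, lennardJones (|z j - z i|) + m / 2 ≤
          ∑ i ∈ Finset.range N, ∑ j ∈ Finset.Ico (i + 1) N, lennardJones (|y j - y i|) ∧
        ∀ (p : ℝ → Prop) [DecidablePred p],
          ((Finset.range (N - 1)).filter (fun l => p (y (l + 1) - y l))).card ≤
            ((Finset.range (n - 1)).filter (fun l => p (z (l + 1) - z l))).card + 2 * m) →
    (∀ (n : ℕ) (y : ℕ → ℝ), (∀ i j : ℕ, i < j → j < n → y i < y j) →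
      (∀ i : ℕ, i + 1 < n → 3 / 4 ≤ y (i + 1) - y i) →
      ∃ z : ℕ → ℝ, (∀ i j : ℕ, i < j → j < n → z i < z j) ∧
        (∀ i : ℕ, i + 1 < n → z (i + 1) - z i = min (y (i + 1) - y i) 1) ∧
        ∑ i ∈ Finset.range n, ∑ j ∈ Finset.Ico (i + 1) n, lennardJones (|z j - z i|) ≤
          ∑ i ∈ Finset.range n, ∑ j ∈ Finset.Ico (i + 1) n, lennardJones (|y j - y i|)) →
    (∀ (a eA C s : ℝ), 3 / 4 ≤ a → a ≤ 1 →
      (∀ N : ℕ, ∑ d ∈ Finset.range N, ((N : ℝ) - d) * lennardJones (d * a) ≤ N * eA + C) →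
      ∀ (n : ℕ) (z : ℕ → ℝ), (∀ i j : ℕ, i < j → j < n → z i < z j) →
        (∀ i : ℕ, i + 1 < n → 3 / 4 ≤ z (i + 1) - z i ∧ z (i + 1) - z i ≤ 1) →
        (∀ y' : ℕ → ℝ, (∀ i j : ℕ, i < j → j < n → y' i < y' j) →
          (n : ℝ) * eA ≤ ∑ i ∈ Finset.range n, ∑ j ∈ Finset.Ico (i + 1) n, lennardJones (|y' j - y' i|)) →
        ∑ i ∈ Finset.range n, ∑ j ∈ Finset.Ico (i + 1) n, lennardJones (|z j - z i|) ≤ n * eA + s →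
        ∑ i ∈ Finset.range (n - 1), (a - (z (i + 1) - z i)) ^ 2 ≤ 2 * (s + C)) →
    (∀ (a : ℝ) (P : PeriodicConfiguration 1) (e : ℤ ≃ P.points), 3 / 4 ≤ a →
      (∀ k : ℤ, ((e k : P.points) : EuclideanSpace ℝ (Fin 1)) = EuclideanSpace.single (0 : Fin 1) ((k : ℝ) * a)) →
      ∀ (R ε : ℝ), 0 < R → 0 < ε →
      ∀ (N : ℕ) (x : Fin N → EuclideanSpace ℝ (Fin 1)) (σ : Equiv.Perm (Fin N)) (y : ℕ → ℝ),
        (∀ i j : ℕ, i < j → j < N → y i < y j) →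
        (∀ i : Fin N, x (σ i) = EuclideanSpace.single (0 : Fin 1) (y i)) →
        ((Nat.card {i : Fin N // ¬ ∃ A : EuclideanSpace ℝ (Fin 1) →ₗᵢ[ℝ] EuclideanSpace ℝ (Fin 1),
            (∀ p ∈ P.points, ‖p‖ ≤ R → ∃ j : Fin N, dist (x j) (x i + A p) ≤ ε) ∧
            (∀ j : Fin N, dist (x j) (x i) ≤ R → ∃ p ∈ P.points, dist (x j) (x i + A p) ≤ ε)} : ℕ) : ℝ) ≤
          2 * (⌈2 * R⌉₊ + 1 : ℕ) + 2 * (⌈2 * R⌉₊ + 1 : ℕ) *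
            (((Finset.range (N - 1)).filter (fun l =>
                min (ε / (⌈2 * R⌉₊ + 1 : ℕ)) (1 / 4) < |a - (y (l + 1) - y l)|)).card : ℝ)) →
    (∀ a : ℝ, 0 < a →
      HasSum (fun k : ℕ => ((k : ℝ) + 1) * ((((k : ℝ) + 1) * a)⁻¹ ^ 7 - (((k : ℝ) + 1) * a)⁻¹ ^ 13)) 0 →
      a < 1 ∧ ∑' k : ℕ, lennardJones (((k : ℝ) + 1) * a) ≤ 0) →
    ∃ P : PeriodicConfiguration 1, ∀ R ε : ℝ, 0 < R → 0 < ε →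
      ∀ x : (N : ℕ) → (Fin N → EuclideanSpace ℝ (Fin 1)), (∀ N, Function.Injective (x N)) →
        Tendsto (fun N : ℕ => (interactionEnergy lennardJones (x N) - groundStateEnergy lennardJones 1 N) / N)
          atTop (𝓝 0) →
        Tendsto (fun N : ℕ => (Nat.card {i : Fin N // ¬ ∃ A : EuclideanSpace ℝ (Fin 1) →ₗᵢ[ℝ] EuclideanSpace ℝ (Fin 1),
            (∀ p ∈ P.points, ‖p‖ ≤ R → ∃ j : Fin N, dist (x N j) (x N i + A p) ≤ ε) ∧
            (∀ j : Fin N, dist (x N j) (x N i) ≤ R → ∃ p ∈ P.points, dist (x N j) (x N i + A p) ≤ ε)} : ℝ) / N)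
          atTop (𝓝 0) := by
  intro hcrowd hcontract hsq hcount hbudget
  obtain ⟨P, hP⟩ := slack_rate hcrowd hcontract hsq hcount hbudget
  refine ⟨P, fun R ε hR hε x hx hexcess => ?_⟩
  obtain ⟨A, B, hA, _hB, hAB⟩ := hP R ε hR hε
  set t : ℕ → ℝ := fun N => (interactionEnergy lennardJones (x N) - groundStateEnergy lennardJones 1 N) / N with htdef
  have ht : Tendsto t atTop (𝓝 0) := hexcess
  have hg : Tendsto (fun N : ℕ => A / (N : ℝ) + B * t N) atTop (𝓝 0) := by
    have h1 : Tendsto (fun N : ℕ => A / (N : ℝ)) atTop (𝓝 0) :=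
      tendsto_const_nhds.div_atTop tendsto_natCast_atTop_atTop
    simpa using h1.add (ht.const_mul B)
  refine tendsto_of_tendsto_of_tendsto_of_le_of_le' tendsto_const_nhds hg ?_ ?_
  · exact Filter.Eventually.of_forall fun N => by positivity
  · filter_upwards [Filter.eventually_ge_atTop 1] with N hN
    have hNpos : (0 : ℝ) < N := by exact_mod_cast hN
    have hb := hAB N (x N) (hx N)
    have h1 : (N : ℝ) * t N = interactionEnergy lennardJones (x N) - groundStateEnergy lennardJones 1 N := by
      simp only [htdef]
      field_simp
    rw [← h1] at hb
    have h2 : A / (N : ℝ) + B * t N = (A + B * (N * t N)) / N := by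
      field_simp
    rw [h2]
    exact div_le_div_of_nonneg_right hb hNpos.le

/-- **QUANTITATIVE SLACK RIGIDITY OF THE LENNARD-JONES CHAIN.**  There is one periodic configuration `P` of `ℝ¹` (the
zero-pressure chain `aℤ`, `a⁶ = ζ(12)/ζ(6)`) such that for all `R, ε > 0` there are `A, B ≥ 0` with: for every `N` and
every configuration `x` of `N` distinct points of the line, the number of particles `i` whose `R`-environment is not
two-way `ε`-matched to `x_i + A'(P.points)` for a linear isometry `A'` is at most `A + B·(E(x) − E(N))` — uniformly in
`N`, the defect count is linear in the energy excess over the ground-state energy.  (For ground states this is c7's O(1)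
bound `pos1d_card_bad_le`; the o(N) statement `slackRigidity_lennardJones_one` is its corollary.) [folklore] -/
theorem slackRigidityRate_lennardJones_one : ∃ P : PeriodicConfiguration 1, ∀ R ε : ℝ, 0 < R → 0 < ε → ∃ A B : ℝ, 0 ≤ A ∧ 0 ≤ B ∧
      ∀ (N : ℕ) (x : Fin N → EuclideanSpace ℝ (Fin 1)), Function.Injective x →
        ((Nat.card {i : Fin N // ¬ ∃ A : EuclideanSpace ℝ (Fin 1) →ₗᵢ[ℝ] EuclideanSpace ℝ (Fin 1),
            (∀ p ∈ P.points, ‖p‖ ≤ R → ∃ j : Fin N, dist (x j) (x i + A p) ≤ ε) ∧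
            (∀ j : Fin N, dist (x j) (x i) ≤ R → ∃ p ∈ P.points, dist (x j) (x i + A p) ≤ ε)} : ℕ) : ℝ) ≤
          A + B * (interactionEnergy lennardJones x - groundStateEnergy lennardJones 1 N) :=
  slack_rate (stub_deleteCrowded stub_deleteEnergy stub_siteEnergyHalf) stub_contract stub_sqSumOfSlack
    stub_localCardBad stub_slackBudget

/-- **SLACK RIGIDITY OF THE LENNARD-JONES CHAIN** — the route's third crux `SlackRigidity` (item stmt-AtomisticToContinuum-11960)
with `3 ↦ 1`, VERBATIM otherwise (= the deciding decl `SlackRigidity1D` of Transfer skeleton IV,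
`Cruxes/ExactCertificate/Lines/closure_makes_nogap_exact_slack1d.lean`): there is one periodic configuration `P` of `ℝ¹` (the
zero-pressure chain `aℤ`) such that for all `R, ε > 0`, along every sequence of injective configurations of the line whose
energy excess over `E(N)` is `o(N)`, all but `o(N)` particles have their `R`-environment two-way `ε`-matched to
`x_i + A(P.points)` for a linear isometry `A` (here the identity).  Composition of the seven landed stubs. [folklore] -/
theorem slackRigidity_lennardJones_one : ∃ P : PeriodicConfiguration 1, ∀ R ε : ℝ, 0 < R → 0 < ε →
      ∀ x : (N : ℕ) → (Fin N → EuclideanSpace ℝ (Fin 1)), (∀ N, Function.Injective (x N)) →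
        Tendsto (fun N : ℕ => (interactionEnergy lennardJones (x N) - groundStateEnergy lennardJones 1 N) / N)
          atTop (𝓝 0) →
        Tendsto (fun N : ℕ => (Nat.card {i : Fin N // ¬ ∃ A : EuclideanSpace ℝ (Fin 1) →ₗᵢ[ℝ] EuclideanSpace ℝ (Fin 1),
            (∀ p ∈ P.points, ‖p‖ ≤ R → ∃ j : Fin N, dist (x N j) (x N i + A p) ≤ ε) ∧
            (∀ j : Fin N, dist (x N j) (x N i) ≤ R → ∃ p ∈ P.points, dist (x N j) (x N i + A p) ≤ ε)} : ℝ) / N)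
          atTop (𝓝 0) :=
  stub_slackAssembly (stub_deleteCrowded stub_deleteEnergy stub_siteEnergyHalf) stub_contract stub_sqSumOfSlack
    stub_localCardBad stub_slackBudget

/-- **THE ROUTE THESIS IN d = 1.**  The thesis `X := ExactCertificate ∧ SlackRigidity` of route ThreeConeCertificate with
`3 ↦ 1`, VERBATIM otherwise: the exact three-cone certificate of the Lennard-Jones chain (c6's `exactCertificate1D`) AND
its slack rigidity (`slackRigidity_lennardJones_one`).  Together with c6/c7's `crystallization_lennardJones_one`
(= the sub-problem `Crystallization` with `3 ↦ 1`) every decl of the route file is now a theorem in d = 1. [folklore] -/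
theorem threeConeThesis_lennardJones_one :
    (∃ (P : PeriodicConfiguration 1) (ρ c : ℝ) (g U f : ℝ → ℝ),
      (∀ r : ℝ, 0 < r → lennardJones r = g r + U r + f r) ∧ (∀ r : ℝ, 0 < r → 0 ≤ U r) ∧
      (∀ r : ℝ, ρ ≤ r → g r = 0) ∧
      (∀ (n : ℕ) (y : Fin n → EuclideanSpace ℝ (Fin 1)) (w : Fin n → ℝ),
        0 ≤ ∑ i, ∑ j, w i * w j * f (dist (y i) (y j))) ∧
      (∀ (N : ℕ) (x : Fin N → EuclideanSpace ℝ (Fin 1)), Function.Injective x →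
        -(c * (N : ℝ)) ≤ interactionEnergy g x) ∧
      c + f 0 / 2 = -(P.energyPerParticle lennardJones)) ∧
    (∃ P : PeriodicConfiguration 1, ∀ R ε : ℝ, 0 < R → 0 < ε →
      ∀ x : (N : ℕ) → (Fin N → EuclideanSpace ℝ (Fin 1)), (∀ N, Function.Injective (x N)) →
        Tendsto (fun N : ℕ => (interactionEnergy lennardJones (x N) - groundStateEnergy lennardJones 1 N) / N)
          atTop (𝓝 0) →
        Tendsto (fun N : ℕ => (Nat.card {i : Fin N // ¬ ∃ A : EuclideanSpace ℝ (Fin 1) →ₗᵢ[ℝ] EuclideanSpace ℝ (Fin 1),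
            (∀ p ∈ P.points, ‖p‖ ≤ R → ∃ j : Fin N, dist (x N j) (x N i + A p) ≤ ε) ∧
            (∀ j : Fin N, dist (x N j) (x N i) ≤ R → ∃ p ∈ P.points, dist (x N j) (x N i + A p) ≤ ε)} : ℝ) / N)
          atTop (𝓝 0)) :=
  ⟨exactCertificate1D, slackRigidity_lennardJones_one⟩

end Summit.AtomisticToContinuum.Crystallization.Theorems.ThreeConeCertificateExactCertificate.Transfer1D

end
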